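import Summits.HodgeConjecture.HodgeConjecture.Theses.CyclicUnitaryPowers
import Summits.HodgeConjecture.HodgeConjecture.Theorems.CyclicUnitaryPowersModelTransfer
import Summits.HodgeConjecture.HodgeConjecture.Theorems.CyclicUnitaryPowersDeckModelClauses
import Summits.HodgeConjecture.HodgeConjecture.Theorems.CyclicUnitaryPowersDeckHodgeOfCarlsonToledo
import Summits.HodgeConjecture.HodgeConjecture.Theorems.CyclicUnitaryPowersLaneDCommutatorClosure
import Summits.HodgeConjecture.HodgeConjecture.Theorems.CyclicUnitaryPowersCyclicSurfacePowersHodge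
import Literature.AlgebraicGeometry.HodgeTheory.AlgebraicMonodromyMumfordTate
import Literature.AlgebraicGeometry.HodgeTheory.MumfordTateCommutatorsHodgeGroupAnyWeight
import Literature.AlgebraicGeometry.HodgeTheory.CyclicCoverReflectionMonodromy
import Literature.AlgebraicGeometry.HodgeTheory.CyclicCoverEigenHodgeNumbers
import Literature.AlgebraicGeometry.HodgeTheory.BettiUniverseAxioms
import Literature.AlgebraicGeometry.HodgeTheory.ComplexConjugationHolds
import Literature.AlgebraicGeometry.HodgeTheory.HodgeRiemannPolarizabilityProofs
import Literature.AlgebraicGeometry.Motives.HodgeTensorFactsHolds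

/-!
# K1 `VeryGeneralDeckCommutatorsInHg` of route `CyclicUnitaryPowers` — the DELIGNE (CMSP 15.3.7) EXIT:
# K1 modulo the Carlson–Toledo facts, the Cattani–Deligne–Kaplan cover and `deligne_finiteIndex_monodromy_le_mumfordTateGroup`
# — André's Theorem 1 is NO LONGER an input

Crux K1 (`stmt-HodgeConjecture-19544`): for a very general ternary `p`-form `f` (`p ≥ 7` prime) every smooth
`X ⊂ ℙ³` cut out by `x₃^p − f` carries a morphism `σ` with the deck properties such that every commutator of two
`σ*`-commuting `tr ∘ ∪`-isometries of `H²(X(ℂ);ℚ)` lies in the Hodge group.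

The landed lane-D close (`CyclicUnitaryPowersKatzGKR.veryGeneralDeckCommutatorsInHg_of_six_facts`, p575851) is
conditional on SIX cited facts, one of which is **André 1992, Thm 1** (`andre1992_algebraicMonodromy_normal_mumfordTateGroup`:
`Mon_s ◁ MT`, `Mon_s ⊆ MT^der` at a Hodge-generic point — fixed part + semisimplicity + derived group).  This file
replaces it by the SHALLOWER **Deligne 1972 Prop. 7.5 / CMSP Lemma–Definition 15.3.7 (i)**
(`deligne_finiteIndex_monodromy_le_mumfordTateGroup`: a finite-index subgroup `Γ'` of the monodromy group lies in
`MT(H²(𝒳_s))` at a Hodge-generic `s`), the binder `stub_cmsp1537` registered on the K1 skeleton and ALREADY carried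
by route B's crux `VeryGeneralSignCommutatorsInHg` (stmt-19716) — i.e. it realises lane A's registered composition
`VeryGeneralDeckCommutatorsInHg_of` (line `unitary-reflection-zariski`, planner P3 v6–v9) with its algebraic brick
B2 now a THEOREM modulo CT71 (`CyclicUnitaryPowersLaneDCommutatorClosure.unitaryReflectionDensity_of_CT71`):

* `veryGeneralDeckCommutatorsInHg_of_deligne` — K1 from the three Carlson–Toledo family facts, the CDK cover,
  CMSP 15.3.7 (i) and B2 (hypothesis `hB2`, B2's registered signature verbatim): very general ⇒ Hodge generic (CDK);
  `Γ' ≤ MT` of finite index (15.3.7 (i)); the commutator of the two transported `σ`-unitary automorphisms lies in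
  `(⁅Γ', Γ'⁆)^Zar(ℚ)` (B2), hence in `Hg` (landed any-weight brick B1
  `mem_hodgeGroup_of_mem_glZariskiClosure_commutator`, the fibre's Hodge structure being polarizable); transport back.
* `veryGeneralDeckCommutatorsInHg_of_six_facts_deligne` — **K1 conditional on exactly the six cited facts
  {`nonempty_carlsonToledoFamily`, `carlsonToledo1999_finrank_eigenspace_deck_one`,
  `carlsonToledo1999_finrank_eigenspace_inf_hodgePiece`, `carlsonToledo1999_unitaryReflection_zariskiDense`,
  `cmsp_nonHodgeGenericPoints_countable_algebraic_cover`, `deligne_finiteIndex_monodromy_le_mumfordTateGroup`}** —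
  no André, no Katz (discharged), no UD (discharged).
* `cyclicSurfacePowersHodge_of_six_facts_deligne` — the rung leaf `CyclicSurfacePowersHodge` (stmt-19543) modulo
  the same six facts (via the landed fact-free `cyclicSurfacePowersHodge_of_veryGeneralDeckCommutatorsInHg`).

Honest framing: K1 and the leaf remain CONDITIONAL (six deep geometric/Hodge-theoretic facts: the Carlson–Toledo
family with its Picard–Lefschetz package and eigen-Hodge numbers, Carlson–Toledo's density theorem 7.1,
Cattani–Deligne–Kaplan, Deligne's 15.3.7); nothing here says HC ∕ HC_AV is proved.
-/

noncomputable section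

set_option linter.dupNamespace false

namespace Summit.HodgeConjecture.HodgeConjecture.Theorems.CyclicUnitaryPowersDeligneExit

open Literature.AlgebraicGeometry.Motives Literature.AlgebraicGeometry.HodgeTheory
open Literature.AlgebraicGeometry.HodgeTheory.BettiUniverse
open Literature.AlgebraicTopology.SingularHomology
open CategoryTheory
open Summit.HodgeConjecture.HodgeConjecture.Theorems.CyclicUnitaryPowersDeckModelClauses

/-- **K1 `VeryGeneralDeckCommutatorsInHg` by the DELIGNE (CMSP 15.3.7 (i)) EXIT** = lane A's registered composition
of line `unitary-reflection-zariski`: inputs the Carlson–Toledo facts (`nonempty_carlsonToledoFamily`,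
`carlsonToledo1999_finrank_eigenspace_deck_one` / `…_inf_hodgePiece`), the Cattani–Deligne–Kaplan cover
(`cmsp_nonHodgeGenericPoints_countable_algebraic_cover`), **CMSP Lemma–Definition 15.3.7 (i)**
(`deligne_finiteIndex_monodromy_le_mumfordTateGroup`) and the algebraic brick B2 (`hB2`, registered signature of
`stub_unitaryReflectionDensity` verbatim).  Proof: K1 on the models implies K1 (landed transfer); bad family =
`a_(x₀^p)` followed by the polynomials cutting out the CDK cover, so a very general `f` classifies a Hodge-generic
point `s`; deck clauses (o)–(iv) landed; `Γ' ≤ MT(H²(𝒳_s))` of finite index in the monodromy group (15.3.7 (i));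
for two `σ*`-unitary `g, h` transported along `φ : H²(𝒳_s;ℚ) ≃ H²(X_F;ℚ)` to `τ`-commuting isometries, B2 puts
their commutator in `(⁅Γ', Γ'⁆)^Zar(ℚ)`, B1 (`mem_hodgeGroup_of_mem_glZariskiClosure_commutator`, polarizable fibre)
in the Hodge group, and the kit clause (HG) carries it back. [cite: CarlsonMullerStachPeters2017, Lemma–Definition 15.3.7]
[cite: CarlsonToledo1999, §7 Theorem 7.1] -/
theorem veryGeneralDeckCommutatorsInHg_of_deligne
    (hCT : nonempty_carlsonToledoFamily)
    (hCT1 : carlsonToledo1999_finrank_eigenspace_deck_one)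
    (hCT2 : carlsonToledo1999_finrank_eigenspace_inf_hodgePiece)
    (hCDK : cmsp_nonHodgeGenericPoints_countable_algebraic_cover)
    (h1537 : deligne_finiteIndex_monodromy_le_mumfordTateGroup)
    (hB2 : open Literature.AlgebraicGeometry.Motives Literature.AlgebraicGeometry.HodgeTheory Literature.AlgebraicGeometry.HodgeTheory.BettiUniverse CategoryTheory.Limits in ∀ (V : Type) [AddCommGroup V] [Module ℚ V] [Module.Finite ℚ V] (B : LinearMap.BilinForm ℚ V) (τ : V ≃ₗ[ℚ] V) (p : ℕ) (R : Set V) (Γ : Subgroup (V ≃ₗ[ℚ] V)), p.Prime → 7 ≤ p → B.IsSymm → B.Nondegenerate → τ ^ p = 1 → (∀ x y, B (τ x) (τ y) = B x y) → Module.finrank ℚ ↥(Module.End.eigenspace (τ : V →ₗ[ℚ] V) 1) ≤ 1 → (∀ δ ∈ R, δ ≠ 0 ∧ (∑ i ∈ Finset.range p, (τ ^ i) δ) = 0 ∧ ∀ x ∈ Submodule.span ℚ (Set.range fun i : ℕ => (τ ^ i) δ), (∀ y ∈ Submodule.span ℚ (Set.range fun i : ℕ => (τ ^ i) δ), B x y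 = 0) → x = 0) → (∀ δ ∈ R, ∃ r ∈ Γ, ((∀ x ∈ Submodule.span ℚ (Set.range fun i : ℕ => (τ ^ i) δ), r x = τ x) ∧ (∀ x, (∀ y ∈ Submodule.span ℚ (Set.range fun i : ℕ => (τ ^ i) δ), B x y = 0) → r x = x))) → (Γ ≤ Subgroup.closure {r : V ≃ₗ[ℚ] V | ∃ δ ∈ R, ((∀ x ∈ Submodule.span ℚ (Set.range fun i : ℕ => (τ ^ i) δ), r x = τ x) ∧ (∀ x, (∀ y ∈ Submodule.span ℚ (Set.range fun i : ℕ => (τ ^ i) δ), B x y = 0) → r x = x))}) → (∀ δ ∈ R, ∀ δ' ∈ R, ∃ γ ∈ Γ, γ δ' ∈ Submodule.span ℚ (Set.range fun i : ℕ => (τ ^ i) δ)) → (∀ x, (∑ i ∈ Finset.range p, (τ ^ i) x) = 0 → x ∈ Submodule.span ℚ {y | ∃ δ ∈ R, ∃ i : ℕ, y = (τ ^ i) δ}) → ∀ Γ' : Subgroup (V ≃ₗ[ℚ] V), Γ' ≤ Γ → (Γ'.subgroupOf Γ).FiniteIndex → ∀ g h : V ≃ₗ[ℚ] V, (∀ x,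 g (τ x) = τ (g x)) → (∀ x y, B (g x) (g y) = B x y) → (∀ x, h (τ x) = τ (h x)) → (∀ x y, B (h x) (h y) = B x y) → g * h * g⁻¹ * h⁻¹ ∈ glZariskiClosure ⁅Γ', Γ'⁆) :
    Summit.HodgeConjecture.HodgeConjecture.Theses.CyclicUnitaryPowers.VeryGeneralDeckCommutatorsInHg := by
  have hDeckH := Summit.HodgeConjecture.HodgeConjecture.Theorems.CyclicUnitaryPowersDeckHodgeOfCarlsonToledo.cyclicDeckHodge_of_carlsonToledo hCT1 hCT2
  refine Summit.HodgeConjecture.HodgeConjecture.Theorems.CyclicUnitaryPowersModelTransfer.stub_cyclicModelTransfer ?_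
  intro p hp h7
  have hodd : Odd p := hp.odd_of_ne_two (by omega)
  obtain ⟨𝔉⟩ := hCT hodd (by omega)
  haveI hHTF : HodgeTensorFacts.{0, 0} := hodgeTensorFacts_holds
  haveI : ∀ t : ComplexPoints 𝔉.S, Module.Finite ℚ (bettiCohomology (fiberOver 𝔉.u t) 2) := fun t => 𝔉.finite t 2
  -- real (hence Hodge-symmetric) Hodge models of the fibres
  have hAm := fun t : ComplexPoints 𝔉.S =>
    exists_isReal_hodgeModel_holds.exists_isHodgeSymmetric (𝔉.isSmoothProjectiveFamily.isSmoothProjective t)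
  let A : ∀ t : ComplexPoints 𝔉.S, HodgeModel 2 (fiberOver 𝔉.u t) := fun t => (hAm t).choose
  have hA : ∀ t, (A t).IsHodgeSymmetric := fun t => (hAm t).choose_spec
  -- the Cattani–Deligne–Kaplan cover of the non-Hodge-generic points of the base
  obtain ⟨W, hW, hcov⟩ := hCDK 𝔉.u 2 2 𝔉.isSmoothProjectiveFamily 𝔉.isQuasiProjectiveOver 𝔉.smooth
    𝔉.irreducibleSpace 𝔉.locallyTrivial A hA
  -- each member of the cover is avoided off one nonzero polynomial condition on the coefficients
  choose G hG₀ hG using fun j => 𝔉.alg (W j) (hW j).1 (hW j).2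
  -- the bad family: the coordinate `a_(x₀^p)` (forcing `f ≠ 0`) followed by the `G j`
  have hdeg : (Finsupp.single (0 : Fin 3) p).degree = p := by simp [Finsupp.degree_single]
  refine ⟨fun i => if i = 0 then MvPolynomial.X ⟨Finsupp.single 0 p, hdeg⟩ else G (i - 1), ?_, ?_⟩
  · intro i
    by_cases hi : i = 0
    · subst hi
      refine ⟨MvPolynomial.X 0 ^ p, by simpa using (MvPolynomial.isHomogeneous_X ℂ (0 : Fin 3)).pow p, ?_⟩
      simp [MvPolynomial.coeff_X_pow]
    · simpa only [hi, if_false] using hG₀ (i - 1)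
  intro f hf hgen' hXF ha
  have hf0 : f ≠ 0 := by
    rintro rfl
    exact hgen' 0 (by simp)
  have hgen : ∀ j, MvPolynomial.eval (fun d : {d : Fin 3 →₀ ℕ // d.degree = p} => f.coeff d.1) (G j) ≠ 0 :=
    fun j => by simpa only [Nat.succ_ne_zero, if_false, Nat.add_sub_cancel] using hgen' (j + 1)
  -- the deck clauses on the model: (o)–(ii) routine (landed), (iii)–(iv) from the Carlson–Toledo facts
  obtain ⟨ha', h1, h2⟩ := exists_cyclicDeckModel_clauses_one_two hp.ne_zero f hXF
  obtain ⟨h3, h4⟩ := hDeckH hp h7 f hf hf0 hXF ha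
  have h1' : pull (diagonalAut (MvPolynomial.X (Fin.last 3) ^ p - MvPolynomial.rename Fin.castSucc f) ha) 2 ^ p = 1 := by
    rw [diagonalAut_congr _ ha ha' rfl]; exact h1
  have h2' : ∀ x y, tr hXF (2 + 2) (cup _ 2 2
      (pull (diagonalAut (MvPolynomial.X (Fin.last 3) ^ p - MvPolynomial.rename Fin.castSucc f) ha) 2 x)
      (pull (diagonalAut (MvPolynomial.X (Fin.last 3) ^ p - MvPolynomial.rename Fin.castSucc f) ha) 2 y)) =
      tr hXF (2 + 2) (cup _ 2 2 x y) := by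
    rw [diagonalAut_congr _ ha ha' rfl]; exact h2
  refine ⟨⟨h1', h2', h3, h4⟩, ?_⟩
  intro g h hg hh
  -- the envelope kit of the fibre over the classifying point `s = pt f`
  have hXF' : IsSmoothProjective 2 (SmoothHypersurface.hypersurface (cyclicCoverForm p f)) := hXF
  have haF : deckUnit p ∈ diagonalStabilizer (cyclicCoverForm p f) := ha
  obtain ⟨φ, B, hBs, hBn, τ, hτp, R, hτB, hφτ, hφB, hHG, hfix, hP1, hP2, hP3, hP4, hP5⟩ :=
    𝔉.exists_envelopeKit f hf hf0 hXF' haF exists_isReal_hodgeModel_holds hodgePQ_independent_of_hodgeModel_holds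
      h1' h2' h3.le (A (𝔉.pt f)) (hA (𝔉.pt f))
  -- re-type `φ` on the route's spelling of the model (`cyclicCoverForm p f` unfolds to it), so that
  -- `simp` lemmas match syntactically below
  obtain ⟨φ, rfl⟩ : ∃ φ' : bettiCohomology (fiberOver 𝔉.u (𝔉.pt f)) 2 ≃ₗ[ℚ]
      bettiCohomology (SmoothHypersurface.hypersurface
        (MvPolynomial.X (Fin.last 3) ^ p - MvPolynomial.rename Fin.castSucc f)) 2, φ' = φ := ⟨φ, rfl⟩
  haveI := finite hXF 2
  -- the kit clauses used below, on the route's spelling of the model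
  have hφτ' : ∀ x, φ (τ x) =
      pull (diagonalAut (MvPolynomial.X (Fin.last 3) ^ p - MvPolynomial.rename Fin.castSucc f) ha) 2 (φ x) := hφτ
  have hφB' : ∀ x y, B x y = tr hXF (2 + 2) (cup (SmoothHypersurface.hypersurface
      (MvPolynomial.X (Fin.last 3) ^ p - MvPolynomial.rename Fin.castSucc f)) 2 2 (φ x) (φ y)) := hφB
  have hHG' : ∀ k : bettiCohomology (fiberOver 𝔉.u (𝔉.pt f)) 2 ≃ₗ[ℚ] bettiCohomology (fiberOver 𝔉.u (𝔉.pt f)) 2,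
      k ∈ ((A (𝔉.pt f)).hodgeStructure (𝔉.isSmoothProjectiveFamily.isSmoothProjective (𝔉.pt f)) (hA (𝔉.pt f)) 2).hodgeGroup →
        (φ.symm.trans k).trans φ ∈ (hodge exists_isReal_hodgeModel_holds hXF 2).hodgeGroup := hHG
  -- the classifying point of a very general member is Hodge generic
  have hsgen : IsHodgeGenericPoint 𝔉.u 2 𝔉.locallyTrivial 𝔉.isSmoothProjectiveFamily A hA ⟨𝔉.pt f, Set.mem_univ _⟩ := by
    by_contra hns
    obtain ⟨j, hj⟩ := hcov ⟨𝔉.pt f, Set.mem_univ _⟩ hns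
    exact hG j f hf hXF (hgen j) hj
  -- CMSP 15.3.7 (i): a finite-index subgroup `Γ'` of the monodromy group lies in `MT(H²(𝒳_s))`
  obtain ⟨Γ', hΓ'le, hΓ'fi, hΓ'MT⟩ := (h1537 𝔉.u 2 2 𝔉.isSmoothProjectiveFamily 𝔉.isQuasiProjectiveOver 𝔉.smooth
    𝔉.locallyTrivial A hA ⟨𝔉.pt f, Set.mem_univ _⟩ hsgen).1
  -- transport the two σ-unitary automorphisms to the fibre
  have hστ : ∀ y, τ (φ.symm y) =
      φ.symm (pull (diagonalAut (MvPolynomial.X (Fin.last 3) ^ p - MvPolynomial.rename Fin.castSucc f) ha) 2 y) :=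
    fun y => by
    apply φ.injective
    rw [hφτ', LinearEquiv.apply_symm_apply, LinearEquiv.apply_symm_apply]
  have cenτ : ∀ k : bettiCohomology (SmoothHypersurface.hypersurface
        (MvPolynomial.X (Fin.last 3) ^ p - MvPolynomial.rename Fin.castSucc f)) 2 ≃ₗ[ℚ]
      bettiCohomology (SmoothHypersurface.hypersurface
        (MvPolynomial.X (Fin.last 3) ^ p - MvPolynomial.rename Fin.castSucc f)) 2,
      (∀ x, k (pull (diagonalAut (MvPolynomial.X (Fin.last 3) ^ p - MvPolynomial.rename Fin.castSucc f) ha) 2 x) =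
        pull (diagonalAut (MvPolynomial.X (Fin.last 3) ^ p - MvPolynomial.rename Fin.castSucc f) ha) 2 (k x)) →
      ∀ x, ((φ.trans k).trans φ.symm) (τ x) = τ (((φ.trans k).trans φ.symm) x) := by
    intro k hk x
    simp only [LinearEquiv.trans_apply]
    rw [hφτ', hk, hστ]
  have cenB : ∀ k : bettiCohomology (SmoothHypersurface.hypersurface
        (MvPolynomial.X (Fin.last 3) ^ p - MvPolynomial.rename Fin.castSucc f)) 2 ≃ₗ[ℚ]
      bettiCohomology (SmoothHypersurface.hypersurface
        (MvPolynomial.X (Fin.last 3) ^ p - MvPolynomial.rename Fin.castSucc f)) 2,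
      (∀ x y, tr hXF (2 + 2) (cup (SmoothHypersurface.hypersurface
          (MvPolynomial.X (Fin.last 3) ^ p - MvPolynomial.rename Fin.castSucc f)) 2 2 (k x) (k y)) =
        tr hXF (2 + 2) (cup (SmoothHypersurface.hypersurface
          (MvPolynomial.X (Fin.last 3) ^ p - MvPolynomial.rename Fin.castSucc f)) 2 2 x y)) →
      ∀ x y, B (((φ.trans k).trans φ.symm) x) (((φ.trans k).trans φ.symm) y) = B x y := by
    intro k hk x y
    simp only [LinearEquiv.trans_apply]
    rw [hφB', LinearEquiv.apply_symm_apply, LinearEquiv.apply_symm_apply, hk, ← hφB']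
  -- B2: the commutator of the transported pair lies in the ℚ-Zariski closure of `⁅Γ', Γ'⁆`
  have hc : ((φ.trans g).trans φ.symm) * ((φ.trans h).trans φ.symm) * ((φ.trans g).trans φ.symm)⁻¹ *
      ((φ.trans h).trans φ.symm)⁻¹ ∈ glZariskiClosure ⁅Γ', Γ'⁆ :=
    hB2 (bettiCohomology (fiberOver 𝔉.u (𝔉.pt f)) 2) B τ p R (ratMonodromyGroup 𝔉.u 2 𝔉.locallyTrivial ⟨𝔉.pt f, Set.mem_univ _⟩)
      hp h7 hBs hBn hτp hτB hfix hP1 hP2 hP3 hP4 hP5 Γ' hΓ'le hΓ'fi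
      ((φ.trans g).trans φ.symm) ((φ.trans h).trans φ.symm) (cenτ g hg.1) (cenB g hg.2) (cenτ h hh.1) (cenB h hh.2)
  -- B1 (landed, any weight): `(⁅Γ', Γ'⁆)^Zar(ℚ) ⊆ Hg` for `Γ' ≤ MT`, the fibre's Hodge structure being polarizable
  have hcomm := mem_hodgeGroup_of_mem_glZariskiClosure_commutator
    ((A (𝔉.pt f)).hodgeStructure (𝔉.isSmoothProjectiveFamily.isSmoothProjective (𝔉.pt f)) (hA (𝔉.pt f)) 2)
    (smoothProjective_hodgeStructure_isPolarizable_holds (𝔉.isSmoothProjectiveFamily.isSmoothProjective (𝔉.pt f))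
      (A (𝔉.pt f)) (hA (𝔉.pt f)) 2) hΓ'MT hc
  -- transport back to `H²(X_F;ℚ)` along `φ`
  have hback := hHG' _ hcomm
  have hid : (φ.symm.trans (((φ.trans g).trans φ.symm) * ((φ.trans h).trans φ.symm) * ((φ.trans g).trans φ.symm)⁻¹ *
      ((φ.trans h).trans φ.symm)⁻¹)).trans φ = g * h * g⁻¹ * h⁻¹ := by
    ext x
    simp only [LinearEquiv.mul_apply, LinearEquiv.trans_apply, LinearEquiv.coe_inv, LinearEquiv.symm_trans_apply,
      LinearEquiv.symm_symm, LinearEquiv.apply_symm_apply]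
  rw [← hid]
  exact hback


/-- **K1 conditional on exactly SIX cited facts, WITHOUT André**: the three Carlson–Toledo family facts,
Carlson–Toledo's density theorem CT71 (`carlsonToledo1999_unitaryReflection_zariskiDense`, which yields B2 by
`unitaryReflectionDensity_of_CT71` — Katz's GKR' and the unitary-density fact UD being theorems), the
Cattani–Deligne–Kaplan cover and Deligne/CMSP 15.3.7 (i). [cite: CarlsonMullerStachPeters2017, Lemma–Definition 15.3.7]
[cite: CarlsonToledo1999, §7 Theorem 7.1] -/
theorem veryGeneralDeckCommutatorsInHg_of_six_facts_deligne
    (hCT : nonempty_carlsonToledoFamily)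
    (hCT1 : carlsonToledo1999_finrank_eigenspace_deck_one)
    (hCT2 : carlsonToledo1999_finrank_eigenspace_inf_hodgePiece)
    (hCT71 : carlsonToledo1999_unitaryReflection_zariskiDense)
    (hCDK : cmsp_nonHodgeGenericPoints_countable_algebraic_cover)
    (h1537 : deligne_finiteIndex_monodromy_le_mumfordTateGroup) :
    Summit.HodgeConjecture.HodgeConjecture.Theses.CyclicUnitaryPowers.VeryGeneralDeckCommutatorsInHg :=
  veryGeneralDeckCommutatorsInHg_of_deligne @hCT @hCT1 @hCT2 @hCDK @h1537
    (CyclicUnitaryPowersLaneDCommutatorClosure.unitaryReflectionDensity_of_CT71 @hCT71)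

/-- **The rung leaf `CyclicSurfacePowersHodge` (stmt-HodgeConjecture-19543) modulo the same six facts, WITHOUT
André** (the landed fact-free step `cyclicSurfacePowersHodge_of_veryGeneralDeckCommutatorsInHg`, p563577).
[cite: CarlsonMullerStachPeters2017, Lemma–Definition 15.3.7] [cite: CarlsonToledo1999, §7 Theorem 7.1] -/
theorem cyclicSurfacePowersHodge_of_six_facts_deligne
    (hCT : nonempty_carlsonToledoFamily)
    (hCT1 : carlsonToledo1999_finrank_eigenspace_deck_one)
    (hCT2 : carlsonToledo1999_finrank_eigenspace_inf_hodgePiece)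
    (hCT71 : carlsonToledo1999_unitaryReflection_zariskiDense)
    (hCDK : cmsp_nonHodgeGenericPoints_countable_algebraic_cover)
    (h1537 : deligne_finiteIndex_monodromy_le_mumfordTateGroup) :
    Summit.HodgeConjecture.HodgeConjecture.Theses.CyclicUnitaryPowers.CyclicSurfacePowersHodge :=
  CyclicUnitaryPowersCyclicSurfacePowersHodge.cyclicSurfacePowersHodge_of_veryGeneralDeckCommutatorsInHg
    (veryGeneralDeckCommutatorsInHg_of_six_facts_deligne @hCT @hCT1 @hCT2 @hCT71 @hCDK @h1537)

end Summit.HodgeConjecture.HodgeConjecture.Theorems.CyclicUnitaryPowersDeligneExit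

end
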